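import Literature.Barriers.CriticalPhenomena.RigorousRGSmallParameterLocalisationBound
import HarnessLib

/-!
# `RigorousRGSmallParameter` (Slade, Theorem 1.4.1): the lattice Leibniz bound and the localisation
# bound with derivative hypotheses on a bounded range of regions ([BS-rg-loc] (e:FXbd) + Lemma 3.3.1)

Companion ("proof architecture") file of
`Literature/Barriers/CriticalPhenomena/RigorousRGSmallParameter.lean` (Loc norm-estimates layer).
Refinement of `…LatticeLeibniz.abs_napply_mul_le` and `…LocalisationBound.abs_TphiPairing_le_of_local`
needed for polynomially growing test functions such as the dual functions `f_m^{(a)}` of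
[BS-rg-loc] Lemma 3.3.2 ("`‖f_m^{(a)}‖_{Φ(X)} ≤ C̄𝔥^{-m}R^{|α(m)|₁}`" — a bound on `X_{2t}` only): the
derivative bounds are required only on the regions `P r` with `r ≤ r₀` that the `|β| ≤ r₀` shifts can
reach ("it is possible to estimate the `Φ(X)` norm of a test function `g` using the values of `g`
only in `X_{2t}`", [BS-rg-loc] §3.3). All PROVED, 0 sorry:

* `DerivBdOn` (+`mono_budget`, `mono_range`), `derivBdOn_diffOp`, `derivBdOn_shiftOp`,
  **`abs_napply_mul_le_of_le`** (`r + |β| ≤ r₀`);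
* `abs_napply_mul_cutSeq_le'`, `napply_eq_zero_of_length_lt`, **`abs_TphiPairing_le_of_local'`**
  (`r₀ = p_Φ p`).

Sources: D. C. Brydges, G. Slade, *A renormalisation group method. II. Approximation by local
polynomials*, J. Stat. Phys. 159 (2015) 461–491, arXiv:1403.7253, §2.2 ((e:FXbd)), §3.3 (Lemma 3.3.1,
the quoted sentence), TeX-source numbering.

## References

* [BrydgesSlade2015RGII] D. C. Brydges, G. Slade, *A renormalisation group method. II.
  Approximation by local polynomials*, J. Stat. Phys. **159** (2015) 461–491, arXiv:1403.7253.
-/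

noncomputable section

namespace Literature.Barriers.CriticalPhenomena

namespace LongRangePhi4

namespace Tphi

open Finset

section LeibnizOn

variable {Λ : Type*} [AddCommGroup Λ] {ι : Type*} {S : Type*} (step : S → Λ)

/-- Derivative bounds on the regions `P r` for `r ≤ r₀` only. [folklore] -/
def DerivBdOn (P : ℕ → List (Λ × ι) → Prop) (r₀ : ℕ) (b : ℕ → ℕ) (F : ℕ → ℕ → ℝ) (f : List (Λ × ι) → ℝ) : Prop :=
  ∀ (r : ℕ) (γ : List (ℕ × S)) (z : List (Λ × ι)), r ≤ r₀ → (∀ p, countAt p γ ≤ b p) → P r z → |napply step γ f z| ≤ F r γ.length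

/-- Lowering the budget. [folklore] -/
theorem DerivBdOn.mono_budget {P : ℕ → List (Λ × ι) → Prop} {r₀ : ℕ} {b b' : ℕ → ℕ} (hbb : ∀ p, b' p ≤ b p) {F : ℕ → ℕ → ℝ}
    {f : List (Λ × ι) → ℝ} (h : DerivBdOn step P r₀ b F f) : DerivBdOn step P r₀ b' F f :=
  fun r γ z hr hγ hz => h r γ z hr (fun p => (hγ p).trans (hbb p)) hz

/-- Lowering the range. [folklore] -/
theorem DerivBdOn.mono_range {P : ℕ → List (Λ × ι) → Prop} {r₀ r₁ : ℕ} (h01 : r₁ ≤ r₀) {b : ℕ → ℕ} {F : ℕ → ℕ → ℝ}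
    {f : List (Λ × ι) → ℝ} (h : DerivBdOn step P r₀ b F f) : DerivBdOn step P r₁ b F f :=
  fun r γ z hr hγ hz => h r γ z (hr.trans h01) hγ hz

/-- Bounds for `∇_q f` under the lowered budget (bounded range). [folklore] -/
theorem derivBdOn_diffOp {P : ℕ → List (Λ × ι) → Prop} {r₀ : ℕ} {b : ℕ → ℕ} {k : ℕ} (hk : 1 ≤ b k) (s : S)
    {F : ℕ → ℕ → ℝ} {f : List (Λ × ι) → ℝ} (h : DerivBdOn step P r₀ b F f) :
    DerivBdOn step P r₀ (lowerAt b k) (fun r i => F r (i + 1)) (diffOp k (step s) f) := by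
  intro r γ z hr hγ hz
  have e : napply step γ (diffOp k (step s) f) = napply step (γ ++ [(k, s)]) f := (napply_append_singleton step γ (k, s) f).symm
  rw [e]
  have h1 := h r (γ ++ [(k, s)]) z hr (countAt_append_singleton_le hk hγ s) hz
  simpa using h1

/-- Bounds for `τ_q g` one region up (bounded range shrinks by one). [folklore] -/
theorem derivBdOn_shiftOp {P : ℕ → List (Λ × ι) → Prop} (hP : RegionSys step P) {r₀ : ℕ} {b : ℕ → ℕ} (k : ℕ) (s : S)
    {G : ℕ → ℕ → ℝ} {g : List (Λ × ι) → ℝ} (h : DerivBdOn step P (r₀ + 1) b G g) :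
    DerivBdOn step P r₀ b (fun r i => G (r + 1) i) (shiftOp k (step s) g) := by
  intro r γ z hr hγ hz
  rw [napply_shiftOp]
  exact h (r + 1) γ _ (by omega) hγ (hP.shift r z k s hz)

/-- **The lattice Leibniz bound with hypotheses on a bounded range of regions**: if the derivative
bounds for `f, g` hold on `P r` for `r ≤ r₀`, the conclusion holds for `z ∈ P r` whenever
`r + |β| ≤ r₀`. [cite: BrydgesSlade2015RGII, §3.3 (proof of Lemma 3.3.1)] -/
theorem abs_napply_mul_le_of_le {P : ℕ → List (Λ × ι) → Prop} (hP : RegionSys step P) :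
    ∀ (β : List (ℕ × S)) (r₀ : ℕ) (b : ℕ → ℕ) (F G : ℕ → ℕ → ℝ) (f g : List (Λ × ι) → ℝ),
      (∀ p, countAt p β ≤ b p) → (∀ r i, 0 ≤ F r i) → (∀ r i, 0 ≤ G r i) →
      (∀ r r' i, r ≤ r' → F r i ≤ F r' i) → (∀ r r' i, r ≤ r' → G r i ≤ G r' i) →
      DerivBdOn step P r₀ b F f → DerivBdOn step P r₀ b G g →
      ∀ (r : ℕ) (z : List (Λ × ι)), r + β.length ≤ r₀ → P r z →
        |napply step β (fun w => f w * g w) z| ≤ leibnizBd F G r β.length := by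
  intro β
  induction β using List.reverseRecOn with
  | nil =>
      intro r₀ b F G f g _ hF0 hG0 _ _ hf hg r z hr hz
      simp only [napply_nil, leibnizBd, List.length_nil, Finset.Nat.antidiagonal_zero, Finset.sum_singleton,
        Nat.choose_zero_right, Nat.cast_one, one_mul, add_zero, abs_mul]
      have h1 := hf r [] z (by simpa using hr) (fun p => by simp [countAt]) hz
      have h2 := hg r [] z (by simpa using hr) (fun p => by simp [countAt]) hz
      simp only [napply_nil, List.length_nil] at h1 h2
      exact mul_le_mul h1 h2 (abs_nonneg _) (hF0 _ _)
  | append_singleton β q ih =>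
      intro r₀ b F G f g hβ hF0 hG0 hFm hGm hf hg r z hr hz
      obtain ⟨k, s⟩ := q
      rw [List.length_append, List.length_singleton] at hr
      have hk : 1 ≤ b k := by
        have h := hβ k
        rw [countAt_append, countAt_singleton, if_pos rfl] at h
        omega
      have hβ' : ∀ p, countAt p β ≤ lowerAt b k p := by
        intro p
        have h := hβ p
        rw [countAt_append, countAt_singleton] at h
        unfold lowerAt
        by_cases hp : p = k
        · subst hp; rw [if_pos rfl] at h ⊢; omega
        · rw [if_neg hp] at h ⊢; omega
      rw [napply_append_singleton, diffOp_mul, napply_add', Pi.add_apply]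
      -- restrict everything to the range `r₀' = r + |β| + 1 ≤ r₀` … we simply keep `r₀` and use `r₀ - 1` for the shift
      obtain ⟨r₁, hr₁⟩ : ∃ r₁, r₀ = r₁ + 1 := ⟨r₀ - 1, by omega⟩
      subst hr₁
      have hf1 := derivBdOn_diffOp step hk s (hf.mono_range step (Nat.le_succ r₁))
      have hg1 := (derivBdOn_shiftOp step hP k s hg).mono_budget step (lowerAt_le b k)
      have hf2 := (hf.mono_range step (Nat.le_succ r₁)).mono_budget step (lowerAt_le b k)
      have hg2 : DerivBdOn step P r₁ (lowerAt b k) (fun r i => G r (i + 1)) (diffOp k (step s) g) :=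
        derivBdOn_diffOp step hk s (hg.mono_range step (Nat.le_succ r₁))
      have t1 := ih r₁ (lowerAt b k) (fun r i => F r (i + 1)) (fun r i => G (r + 1) i) _ _ hβ'
        (fun r i => hF0 _ _) (fun r i => hG0 _ _) (fun r r' i h => hFm _ _ _ h) (fun r r' i h => hGm _ _ _ (by omega)) hf1 hg1 r z
        (by omega) hz
      have t2 := ih r₁ (lowerAt b k) F (fun r i => G r (i + 1)) _ _ hβ'
        hF0 (fun r i => hG0 _ _) hFm (fun r r' i h => hGm _ _ _ h) hf2 hg2 r z (by omega) hz
      refine (abs_add_le _ _).trans ((add_le_add t1 t2).trans ?_)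
      simp only [leibnizBd, List.length_append, List.length_singleton]
      rw [Finset.sum_antidiagonal_choose_succ_mul (fun i j => F (r + (β.length + 1)) i * G (r + (β.length + 1)) j) β.length,
        add_comm]
      refine add_le_add (Finset.sum_le_sum fun ij hij => ?_) (Finset.sum_le_sum fun ij hij => ?_)
      · refine mul_le_mul_of_nonneg_left (mul_le_mul (hFm _ _ _ (by omega)) (hGm _ _ _ (by omega)) (hG0 _ _) (hF0 _ _)) (by positivity)
      · rw [Finset.mem_antidiagonal] at hij
        rw [← Nat.choose_symm_of_eq_add hij.symm]
        refine mul_le_mul_of_nonneg_left (mul_le_mul (hFm _ _ _ (by omega)) (hGm _ _ _ (by omega)) (hG0 _ _) (hF0 _ _)) (by positivity)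

end LeibnizOn

end Tphi

namespace Loc

open Finset Tphi RGNorm LocalPoly Bump Polymer Literature.Probability.LatticeModels
open scoped ContDiff

variable {d M n : ℕ} [NeZero M]

/-- **Derivative bound for `fχ` everywhere, bounded-range hypotheses** (`r₀ ≥ |β|`). [cite: BrydgesSlade2015RGII, §3.3 (proof of Lemma 3.3.1)] -/
theorem abs_napply_mul_cutSeq_le' {c : TorusSite d M} {a₀ w pΦ : ℕ} (hw : 1 ≤ w)
    (hwin : 2 * ((a₀ : ℤ) + pΦ * (w - 1 : ℕ)) < (M : ℤ) - 2 * pΦ) {r₀ : ℕ}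
    {Ff : ℕ → ℕ → ℝ} (hF0 : ∀ r i, 0 ≤ Ff r i) (hFm : ∀ r r' i, r ≤ r' → Ff r i ≤ Ff r' i)
    {f : List (TorusSite d M × Fin n) → ℝ}
    (hf : DerivBdOn (unitStep d M) (boxReg (n := n) c (a₀ + pΦ * (w - 1) + pΦ)) r₀ (fun _ => pΦ) Ff f)
    (β : List (ℕ × (Fin d × Bool))) (hβ : ∀ k, countAt k β ≤ pΦ) (hβr : β.length ≤ r₀) (z : List (TorusSite d M × Fin n)) :
    |napply (unitStep d M) β (fun w' => f w' * cutSeq c a₀ w pΦ w') z| ≤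
      leibnizBd Ff (fun _ i => (2 / w : ℝ) ^ i) 0 β.length := by
  by_cases hz : boxReg (n := n) c (a₀ + pΦ * (w - 1) + pΦ) 0 z
  · refine abs_napply_mul_le_of_le (unitStep d M) (regionSys_boxReg c _) β r₀ (fun _ => pΦ) Ff (fun _ i => (2 / w : ℝ) ^ i)
      f (cutSeq c a₀ w pΦ) hβ hF0 (fun _ _ => by positivity) hFm (fun _ _ _ _ => le_rfl) hf ?_ 0 z (by omega) hz
    intro r γ z' _ hγ _
    exact abs_napply_cutSeq_le hw hwin γ hγ z'
  · unfold boxReg at hz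
    push Not at hz
    obtain ⟨q, hq, j, hj⟩ := hz
    obtain ⟨k, hk, rfl⟩ := exists_getElem_eq_of_mem hq
    rw [napply_mul_cutSeq_eq_zero_of_far f β z k hk j (by have := hβ k; omega), abs_zero]
    unfold leibnizBd
    exact Finset.sum_nonneg fun ij _ => by have := hF0 (0 + β.length) ij.1; positivity

omit [NeZero M] in
/-- `∇^α h_z = 0` for admissible `α` that is too long: more than `p_Φ|z|` differences forces a slot
beyond `|z|`. [folklore] -/
theorem napply_eq_zero_of_length_lt {pΦ : ℕ} {α : List (ℕ × (Fin d × Bool))} (hα : ∀ k, countAt k α ≤ pΦ)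
    (g : List (TorusSite d M × Fin n) → ℝ) (z : List (TorusSite d M × Fin n)) (h : pΦ * z.length < α.length) :
    napply (unitStep d M) α g z = 0 := by
  by_cases hs : ∀ q ∈ α, q.1 < z.length
  · exact absurd (length_le_of_adm ⟨hs, hα⟩) (by omega)
  · push Not at hs
    obtain ⟨q, hq, hqz⟩ := hs
    exact napply_eq_zero_of_le_slot g α z ⟨q, hq, hqz⟩

/-- **The localisation bound with bounded-range hypotheses** (`r₀ = p_Φ p`): for `F ∈ 𝒩(U)`, `U` in
the plateau box, `f` a `p`-variable test function with derivative bounds `Ff` on the box regions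
`r ≤ p_Φ p`, and `N > 0` with `𝔥^{-p}R^m leibnizBd(m) ≤ N` for `m ≤ p_Φ p`:
`|⟨F,f⟩_0| ≤ N‖F‖_{T_0(𝔥,R)}`. [cite: BrydgesSlade2015RGII, §2.2 ((e:FXbd)) and Lemma 3.3.1] -/
theorem abs_TphiPairing_le_of_local' {𝔥 R : ℝ} (h𝔥 : 0 < 𝔥) (hR : 0 < R) {pΦ pN p : ℕ} (hp : p ≤ pN)
    {c : TorusSite d M} {a₀ w : ℕ} (hw : 1 ≤ w) (hwin : 2 * ((a₀ : ℤ) + pΦ * (w - 1 : ℕ)) < (M : ℤ) - 2 * pΦ)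
    {U : Finset (TorusSite d M)} (hU : ∀ x ∈ U, ∀ j, cycDist (c j) (x j) ≤ a₀)
    {F : (TorusSite d M → Fin n → ℝ) → ℝ} (hFU : DependsOn U F) (hFs : ContDiff ℝ ∞ F)
    {f : List (TorusSite d M × Fin n) → ℝ} (hfp : ∀ z, z.length ≠ p → f z = 0)
    {Ff : ℕ → ℕ → ℝ} (hF0 : ∀ r i, 0 ≤ Ff r i) (hFm : ∀ r r' i, r ≤ r' → Ff r i ≤ Ff r' i)
    (hf : DerivBdOn (unitStep d M) (boxReg (n := n) c (a₀ + pΦ * (w - 1) + pΦ)) (pΦ * p) (fun _ => pΦ) Ff f)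
    {N : ℝ} (hN : 0 < N)
    (hNb : ∀ m, m ≤ pΦ * p → leibnizBd Ff (fun _ i => (2 / w : ℝ) ^ i) 0 m * R ^ m ≤ N * 𝔥 ^ p) :
    |TphiPairing pN (basisDir d M n) F 0 f| ≤ N * TphiNorm pN (latticeFamily (unitStep d M) 𝔥 R pΦ) (basisDir d M n) F 0 := by
  set h : List (TorusSite d M × Fin n) → ℝ := fun z => f z * cutSeq c a₀ w pΦ z with hh
  have e1 : TphiPairing pN (basisDir d M n) F 0 f = TphiPairing pN (basisDir d M n) F 0 h := by
    refine TphiPairing_congr_of_dependsOn hFU hFs pN 0 fun z hz => ?_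
    rw [hh]
    simp only
    rw [cutSeq_eq_one hw fun q hq j => hU q.1 (hz q hq) j, mul_one]
  have hhp : ∀ z, z.length ≠ p → h z = 0 := fun z hz => by rw [hh]; simp only; rw [hfp z hz, zero_mul]
  -- derivative bound for `h`, valid for all admissible programmes: short ones by the Leibniz bound,
  -- long ones vanish, wrong lengths vanish
  have hLb : ∀ (α : List (ℕ × (Fin d × Bool))) z, (∀ k, countAt k α ≤ pΦ) →
      |napply (unitStep d M) α h z| ≤ leibnizBd Ff (fun _ i => (2 / w : ℝ) ^ i) 0 α.length := by
    intro α z hα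
    have hnn : 0 ≤ leibnizBd Ff (fun _ i => (2 / w : ℝ) ^ i) 0 α.length := by
      unfold leibnizBd
      exact Finset.sum_nonneg fun ij _ => by have := hF0 (0 + α.length) ij.1; positivity
    by_cases hzl : z.length = p
    · by_cases hαl : α.length ≤ pΦ * p
      · exact abs_napply_mul_cutSeq_le' hw hwin hF0 hFm hf α hα hαl z
      · rw [napply_eq_zero_of_length_lt hα h z (by rw [hzl]; omega), abs_zero]
        exact hnn
    · rw [napply_eq_zero_of_vanish (unitStep d M) α (r := z.length) (fun w' hw' => hhp w' (by omega)) z rfl, abs_zero]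
      exact hnn
  have hball := div_mem_ball_of_napply_le (pΦ := pΦ) h𝔥 hR hp (h := h) hhp hLb hN hNb
  have e2 : TphiPairing pN (basisDir d M n) F 0 h = N * TphiPairing pN (basisDir d M n) F 0 (fun z => N⁻¹ * h z) := by
    unfold TphiPairing
    rw [pairing_smul_right, ← mul_assoc, mul_inv_cancel₀ hN.ne', one_mul]
  rw [e1, e2, abs_mul, abs_of_pos hN]
  exact mul_le_mul_of_nonneg_left (abs_TphiPairing_le_lattice (unitStep d M) h𝔥 hR pΦ pN (basisDir d M n) F 0 hball) hN.le

end Loc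

end LongRangePhi4

end Literature.Barriers.CriticalPhenomena
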